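import Mathlib
import Summits.RiemannHypothesis.RiemannHypothesis.Theorems.DensityLadderSeparatedTowerTransform
import Summits.RiemannHypothesis.RiemannHypothesis.Theorems.DensityLadderSeparatedTowerTransformDecay
import Summits.RiemannHypothesis.RiemannHypothesis.Theorems.DensityLadderSeparatedTowerWindows
import Summits.RiemannHypothesis.RiemannHypothesis.Theorems.DensityLadderSeparatedTowerSchur
import Summits.RiemannHypothesis.RiemannHypothesis.Theorems.DensityLadderSeparatedTowerWindowSums
import HarnessLib

/-!
# `DensityLadder.SeparatedTowerDensityLine` (item stmt-RiemannHypothesis-24918) — pieces of the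
# UPPER half of stub S1 (window-profile domination and the three truncated window sums)

LINE L57 «sieve sight above the density line» (rh-idea-10 g1), crux K1 `SeparatedTowerDensityLine`,
stub S1; see the assembly skeleton `S1-ASSEMBLY-SKELETON.lean` (evidence on
stmt-RiemannHypothesis-24918), whose only remaining sub-goal is `upper`.  This file proves, as
standalone lemmas with small contexts, the ingredients of `upper` that concern the truncated
families at height `T` (`A = 4(T+1)`, `η = 1/A`):
* `norm_transform_le_profile`: `‖ĉ_ρ(η)‖ ≤ H₂(⌊Im ρ⌋)` with the window profile
  `H₂(n) = 4` (`|n| ≤ A+1`), `= (9/2)M₂A²/(|n|−1)²` beyond;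
* `sum_weight_window_le`: the unit-window summation for weights `f_i ≤ H(⌊γ_i⌋)`;
* `tower_trunc_sum_le`, `tame_trunc_sum_le`: `Σ m_i‖ĉ_i‖` over the truncated tower / tame families
  is `≤ B(1/g+1)(30+18M₂)A`, resp. `≤ w_max (30+18M₂)A` when every window mass is `≤ w_max`;
* `tame_schur_sum_le`: `Σ_j m_j e^{−c(γ_j−y)²} ≤ C K log(|y|+2)` for a tame finite family.
Cell rh-split, seat rh-split-prover-l57 g0.  RH-free, ζ-free; FRONTIER bookkeeping; nothing here
bears on the truth of RH.
-/

set_option linter.dupNamespace false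

noncomputable section

open Complex Filter Set MeasureTheory Topology Finset
open scoped Real

namespace Summit.RiemannHypothesis.RiemannHypothesis.Theorems.DensityLadderSeparatedTowerUpperPieces

open Summit.RiemannHypothesis.RiemannHypothesis.Theorems.DensityLadderSeparatedTowerTransform
open Summit.RiemannHypothesis.RiemannHypothesis.Theorems.DensityLadderSeparatedTowerTransformDecay
open Summit.RiemannHypothesis.RiemannHypothesis.Theorems.DensityLadderSeparatedTowerWindows
open Summit.RiemannHypothesis.RiemannHypothesis.Theorems.DensityLadderSeparatedTowerSchur
open Summit.RiemannHypothesis.RiemannHypothesis.Theorems.DensityLadderSeparatedTowerWindowSums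

/-- **Window-profile domination of the transform.** For `φ ∈ C²` vanishing off `(−1,1)` with
`|φ| ≤ 1`, `|φ''| ≤ M₂` (`M₂ ≥ 0`), `A ≥ 2`, `η = 1/A`, and `0 ≤ Re ρ ≤ 1`:
`‖∫_{-1}^{1} φ(v)(1+ηv)^{ρ−1} dv‖ ≤ H₂(⌊Im ρ⌋)`, where `H₂(n) = 4` if `|n| ≤ A+1` and
`H₂(n) = (9/2)M₂A²/(|n|−1)²` otherwise. [folklore] -/
theorem norm_transform_le_profile (φ : ℝ → ℝ) (hφ : ContDiff ℝ 2 φ) (hφs : ∀ v, 1 ≤ |v| → φ v = 0)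
    (hM : ∀ v, |φ v| ≤ 1) {M₂ : ℝ} (hM₂0 : 0 ≤ M₂) (hM₂ : ∀ v, |deriv (deriv φ) v| ≤ M₂)
    {A : ℝ} (hA : 2 ≤ A) {ρ : ℂ} (h0 : 0 ≤ ρ.re) (h1 : ρ.re ≤ 1) :
    ‖∫ v in (-1 : ℝ)..1, (φ v : ℂ) * ((1 : ℂ) + (((1 / A : ℝ)) : ℂ) * (v : ℂ)) ^ (ρ - 1)‖ ≤
      (if |((⌊ρ.im⌋ : ℤ) : ℝ)| ≤ A + 1 then (4 : ℝ) else 9 / 2 * M₂ * A ^ 2 / ((|((⌊ρ.im⌋ : ℤ) : ℝ)| - 1) ^ 2)) := by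
  have hA0 : 0 < A := by linarith
  have hη0 : 0 < 1 / A := by positivity
  have hη1 : 1 / A ≤ 1 / 2 := by rw [div_le_div_iff₀ hA0 (by norm_num)]; linarith
  split_ifs with h
  · have := norm_windowTransform_le φ hM hη0 hη1 h0 h1; linarith
  · rw [not_le] at h
    have hfl := Int.floor_le ρ.im
    have hfl2 := Int.lt_floor_add_one ρ.im
    have hd : |(((⌊ρ.im⌋ : ℤ) : ℝ)) - ρ.im| ≤ 1 := abs_le.2 ⟨by linarith, by linarith⟩
    have habsγ : |((⌊ρ.im⌋ : ℤ) : ℝ)| - 1 ≤ |ρ.im| := by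
      have := abs_sub_abs_le_abs_sub (((⌊ρ.im⌋ : ℤ) : ℝ)) ρ.im
      linarith
    have hpos : 0 < |((⌊ρ.im⌋ : ℤ) : ℝ)| - 1 := by linarith
    have hγabs : 0 < |ρ.im| := lt_of_lt_of_le hpos habsγ
    have hγ : ρ.im ≠ 0 := abs_pos.1 hγabs
    have hρ0 : ρ ≠ 0 := fun e ↦ hγ (by rw [e]; simp)
    have hρ1 : ρ + 1 ≠ 0 := fun e ↦ hγ (by have := congrArg Complex.im e; simpa using this)
    have hdec := norm_windowTransform_le_decay φ hφ hφs hM₂ hη0 hη1 h0 h1 hρ0 hρ1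
    refine hdec.trans ?_
    have hρn : |ρ.im| ≤ ‖ρ‖ := Complex.abs_im_le_norm _
    have hρn1 : |ρ.im| ≤ ‖ρ + 1‖ := by
      have := Complex.abs_im_le_norm (ρ + 1); simpa using this
    have hprod : (|((⌊ρ.im⌋ : ℤ) : ℝ)| - 1) ^ 2 ≤ ‖ρ‖ * ‖ρ + 1‖ := by
      rw [sq]
      exact mul_le_mul (habsγ.trans hρn) (habsγ.trans hρn1) hpos.le (norm_nonneg _)
    have e1 : 9 / 2 * M₂ / ((1 / A) ^ 2 * ‖ρ‖ * ‖ρ + 1‖) = 9 / 2 * M₂ * A ^ 2 / (‖ρ‖ * ‖ρ + 1‖) := by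
      field_simp
    rw [e1]
    exact div_le_div_of_nonneg_left (by positivity) (by positivity) hprod

/-- **Unit-window summation for weights** `f_i ≤ H(⌊γ_i⌋)` (a variant of `sum_window_le` in which
the summand need not factor through `γ_i`). [folklore] -/
theorem sum_weight_window_le {ι : Type} (Af : Finset ι) (γ m f : ι → ℝ) (hm : ∀ i, 0 ≤ m i)
    (H : ℤ → ℝ) (hH0 : ∀ n, 0 ≤ H n) (hfH : ∀ i ∈ Af, f i ≤ H ⌊γ i⌋) (w : ℤ → ℝ)
    (hw : ∀ n : ℤ, ∑ i ∈ Af.filter (fun i ↦ ⌊γ i⌋ = n), m i ≤ w n) :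
    ∑ i ∈ Af, m i * f i ≤ ∑ n ∈ Af.image (fun i ↦ ⌊γ i⌋), w n * H n := by
  classical
  calc ∑ i ∈ Af, m i * f i ≤ ∑ i ∈ Af, m i * H ⌊γ i⌋ :=
        Finset.sum_le_sum fun i hi ↦ mul_le_mul_of_nonneg_left (hfH i hi) (hm i)
    _ = ∑ n ∈ Af.image (fun i ↦ ⌊γ i⌋), ∑ i ∈ Af.filter (fun i ↦ ⌊γ i⌋ = n), m i * H ⌊γ i⌋ :=
        (Finset.sum_fiberwise_of_maps_to (fun i hi ↦ Finset.mem_image_of_mem _ hi) _).symm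
    _ = ∑ n ∈ Af.image (fun i ↦ ⌊γ i⌋), H n * ∑ i ∈ Af.filter (fun i ↦ ⌊γ i⌋ = n), m i := by
        refine Finset.sum_congr rfl fun n _ ↦ ?_
        rw [Finset.mul_sum]
        refine Finset.sum_congr rfl fun i hi ↦ ?_
        rw [(Finset.mem_filter.1 hi).2, mul_comm]
    _ ≤ ∑ n ∈ Af.image (fun i ↦ ⌊γ i⌋), H n * w n :=
        Finset.sum_le_sum fun n _ ↦ mul_le_mul_of_nonneg_left (hw n) (hH0 n)
    _ = _ := Finset.sum_congr rfl fun n _ ↦ mul_comm _ _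

/-- **Truncated sums against the window profile with bounded window masses**: if every window of
`Af` has mass `≤ wmax` (`wmax ≥ 0`) and `f_i ≤ H₂(⌊γ_i⌋)` for the profile of
`norm_transform_le_profile` (`A ≥ 2`, `M₂ ≥ 0`), then `Σ_{i∈Af} m_i f_i ≤ wmax (30+18M₂) A`.
[folklore] -/
theorem sum_profile_le {ι : Type} (Af : Finset ι) (γ m f : ι → ℝ) (hm : ∀ i, 0 ≤ m i)
    {A M₂ wmax : ℝ} (hA : 2 ≤ A) (hM₂ : 0 ≤ M₂) (hwmax : 0 ≤ wmax)
    (hfH : ∀ i ∈ Af, f i ≤ (if |((⌊γ i⌋ : ℤ) : ℝ)| ≤ A + 1 then (4 : ℝ)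
      else 9 / 2 * M₂ * A ^ 2 / ((|((⌊γ i⌋ : ℤ) : ℝ)| - 1) ^ 2)))
    (hw : ∀ n : ℤ, ∑ i ∈ Af.filter (fun i ↦ ⌊γ i⌋ = n), m i ≤ wmax) :
    ∑ i ∈ Af, m i * f i ≤ wmax * ((30 + 18 * M₂) * A) := by
  classical
  set H₂ : ℤ → ℝ := fun n ↦ if |(n : ℝ)| ≤ A + 1 then (4 : ℝ) else 9 / 2 * M₂ * A ^ 2 / ((|(n : ℝ)| - 1) ^ 2)
    with hH₂
  have hH₂0 : ∀ n, 0 ≤ H₂ n := fun n ↦ by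
    rw [hH₂]; simp only; split_ifs
    · norm_num
    · positivity
  have h := sum_weight_window_le Af γ m f hm H₂ hH₂0 (fun i hi ↦ by rw [hH₂]; exact hfH i hi)
    (fun _ ↦ wmax) hw
  refine h.trans ?_
  rw [← Finset.mul_sum]
  refine mul_le_mul_of_nonneg_left ?_ hwmax
  have := sum_window_profile_le (Af.image (fun i ↦ ⌊γ i⌋)) hA hM₂
  rw [hH₂]; exact this

/-- **Tame Schur sum**: for a finite family whose windows have mass `≤ C log(|n|+2)` (`C ≥ 0`) and
`c > 0`, with `K` the constant of `exists_window_gauss_log_le`,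
`Σ_{j} m_j e^{−c(γ_j − y)²} ≤ C K log(|y| + 2)`. [folklore] -/
theorem tame_schur_sum_le {ι : Type} (Af : Finset ι) (γ m : ι → ℝ) (hm : ∀ i, 0 ≤ m i)
    {C c K : ℝ} (hC : 0 ≤ C) (hc : 0 < c)
    (hK : ∀ (y : ℝ) (S : Finset ℤ), ∑ n ∈ S, Real.log (|(n : ℝ)| + 2) *
      Real.exp (c - c * (((n - ⌊y⌋ : ℤ) : ℝ)) ^ 2 / 2) ≤ K * Real.log (|y| + 2))
    (hw : ∀ n : ℤ, ∑ i ∈ Af.filter (fun i ↦ ⌊γ i⌋ = n), m i ≤ C * Real.log (|(n : ℝ)| + 2)) (y : ℝ) :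
    ∑ j ∈ Af, m j * Real.exp (-(c * (γ j - y) ^ 2)) ≤ C * K * Real.log (|y| + 2) := by
  classical
  have h := sum_window_le Af γ m (fun j _ ↦ hm j) (fun s ↦ Real.exp (-(c * (s - y) ^ 2)))
    (fun n ↦ Real.exp (c - c * (((n - ⌊y⌋ : ℤ) : ℝ)) ^ 2 / 2)) (fun n ↦ (Real.exp_pos _).le)
    (fun j _ ↦ exp_neg_sq_le_window hc.le _ _) (fun n ↦ C * Real.log (|(n : ℝ)| + 2)) hw
    (Af.image (fun j ↦ ⌊γ j⌋)) (fun j hj ↦ Finset.mem_image_of_mem _ hj)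
  refine h.trans ?_
  calc ∑ n ∈ Af.image (fun j ↦ ⌊γ j⌋), C * Real.log (|(n : ℝ)| + 2) *
        Real.exp (c - c * (((n - ⌊y⌋ : ℤ) : ℝ)) ^ 2 / 2)
      = C * ∑ n ∈ Af.image (fun j ↦ ⌊γ j⌋), Real.log (|(n : ℝ)| + 2) *
        Real.exp (c - c * (((n - ⌊y⌋ : ℤ) : ℝ)) ^ 2 / 2) := by
        rw [Finset.mul_sum]; exact Finset.sum_congr rfl fun n _ ↦ by ring
    _ ≤ C * (K * Real.log (|y| + 2)) := mul_le_mul_of_nonneg_left (hK y _) hC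
    _ = C * K * Real.log (|y| + 2) := by ring

end Summit.RiemannHypothesis.RiemannHypothesis.Theorems.DensityLadderSeparatedTowerUpperPieces

end
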